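/-
Copyright: lit-balaban cell, Phase-2 proof seat p03.  Reproduction of published definitions and of an elementary published
argument; nothing is claimed beyond what the kernel checks below.
-/
import Mathlib
import Literature.MathematicalPhysics.QuantumFieldTheory.Balaban1983to89.B6BondElimination

/-!
# `BalabanImbrieJaffe1984to88.BIJ85AxialGauge34` — T. Bałaban, J. Imbrie, A. Jaffe, *Renormalization of the Higgs model:
minimizers, propagators and the stability of mean field theory*, Commun. Math. Phys. **97** (1985) 299–329
[BalabanImbrieJaffe1985]: Sect. 3 p. 306 — the axial gauge δ_{Ax}(u) on the block trees T(y) (3.4) and the residual gauge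
group 𝒢₀; axial gauge fixing on each block tree (existence, uniqueness modulo 𝒢₀) PROVED.  Companion file
`BIJ85AxialGauge35` (same seat): the other two constraint factors of (3.3), δ(v/Qu) (3.5) and δ_H(ψ − Qφ) (3.6).

statement-level skeleton of published theorems with citation tags; proofs where landed; nothing here is a claim about
the Yang–Mills mass gap

PDF held: `paper:balaban1985-cmp97-bij-higgs-minimizers` (journal page = PDF page + 298); p. 306 [PDF 8] and p. 303
[PDF 5] read on the renders `HOME/lit-balaban-r15/pages/1985-cmp97-bij-higgs-minimizers-p008-x2.png`,
`pub-balaban/t4/b2b-balaban-t4-lit2/renders/bij1985/1985-cmp97-bij-higgs-minimizers-p005-x2.png`.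
SKELETON row `C1.Eq3.4-3.6` (`HOME/lit-balaban-r15/ROWS-C1.md` r15-C1-28; owner r15, referee ref-5); Phase-2 seat p03
(lead re-points G.5-20/G.5-23/G.5-28), unit `lit-balaban-p03`, HOME `run/shared/lean/pub/lit-balaban/`.

THE PRINTED TEXT (p. 306 [PDF 8], verbatim).  *"(𝒯e^{−S})(v, ψ) = ∫ e^{−S(u,φ)} δ_{Ax}(u) δ(v/Qu) δ_H(ψ − Qφ) 𝒟u𝒟φ.
(3.3)  In (3.3) we specify the axial gauge with δ_{Ax}(u) which sets u_b = 1 on the set of bonds chosen as follows: Within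
each L-block B(y) with corner y in the L-lattice, let T(y) denote the tree composed of unit bonds in Γ_{yx}. Here x ranges
over B(y), and T(y) is maximal – in the sense that adjoining any additional unit bond b in B(y) to T(y) makes T(y)
multiply connected. Then  δ_{Ax}(u) = Π_{y∈T_L} Π_{b∈T(y)} δ(u_b). (3.4)  Let 𝒢₀ denote the subgroup of gauge
transformations which are specified by h's in (2.7) which are constant on each L-block B(y). These gauge transformations
preserve the axial gauge and affect only bonds on the unit lattice which connect different blocks. They generate the
gauge group of the integral 𝒯(exp −S)."*  With it, p. 303 [PDF 5]: *"let h denote a map from the unit lattice to U(1).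
Then h defines the gauge transformation φ_y → h(y)φ_y ≡ φ^h_y, u_b → h(b₋)h(b₊)^{−1}u_b = u^h_b. (2.7) … In axial gauge
we choose h in order to set u_b = 1 for every b which occurs in some Γ_{yx}. In other words, we specify a maximal tree
T(y) in each block B(y) composed of bonds in any Γ_{yx}, x ∈ B(y)"*, and (2.5) p. 302 *"u(Γ) = Π_{b∈Γ} u_b"*.

CARRIER (dictionary; no new carrier).  The corner-anchored unit lattice of `…Balaban1983to89.B6BondElimination` /
`…B6Elimination` (cell `pub-balaban`): sites `Fin d → ℤ`, unit bonds `(Fin d → ℤ) × Fin d` = ⟨z, z + e_μ⟩, blocks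
`B6Elimination.block L y` = B(y) of (2.4) (*"x ∈ B(y) iff y_j ≤ x_j < y_j + L"*, y ∈ LZ^d a corner; `corner L x` = the
corner of the block of x), the contours `B6BondElimination.contour L y x` = the unit bonds of Γ_{yx} and the trees
`B6BondElimination.treeBonds L y` = T(y) (the union of the Γ_{yx}, x ∈ B(y): `contour_subset_treeBonds`,
`contour_add_unitVec`) — the same dictionary as the neighbouring `BIJ85NoZeroModes309Proof` (p. 309, seat p33), which
records that these ARE the contours of p. 302.  U(1) = Mathlib's `Circle`.  The paper's unit lattice is a torus T₁
(periodic boundary conditions, (2.2)); its blocks, contours and trees are those of ℤ^d read modulo the period, and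
everything below is stated at every block of ℤ^d simultaneously.  U(1) being abelian, u(Γ_{yx}) is the `Finset` product
over the bonds of Γ_{yx} ((2.5); the order of the factors is immaterial).

WHAT IS TYPED (defs with bodies) / PROVED.
* §1 (2.7) on this carrier: `gaugeAct h u` (u^h), `gaugeHiggs h φ` (φ^h); it is an action (`gaugeAct_one`, `gaugeAct_mul`).
* §2 (2.5) `hol L u y x` = u(Γ_{yx}); `hol_tip` (u(Γ_{y,z+e_μ}) = u_{⟨z,z+e_μ⟩}u(Γ_{yz}) along the tree); `block_induction`
  (T(y) reaches every x ∈ B(y): induction along the tree, the combinatorial content of "maximal tree"); the telescoping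
  `hol_gaugeAct` (u^h(Γ_{yx}) = h(y)u(Γ_{yx})h(x)^{−1}, the mechanism of (2.8)) PROVED.
* §3 **(3.4)**: `IsTreeBond L b` (b ∈ T(y) for the block B(y) ∋ b₋), `IsAxial L u` = the support of δ_{Ax}
  (u_b = 1 on every tree bond of every block) with the printed double-product reading `isAxial_iff_blocks`
  (∀ y ∈ LZ^d, ∀ b ∈ T(y), u_b = 1) and the p. 303 reading `isAxial_iff_hol` (u(Γ_{yx}) = 1 for all x ∈ B(y)) PROVED
  equivalent; tree bonds join sites of the same block (`corner_tip_eq`).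
* §4 **𝒢₀** = `G0 L d : Subgroup ((Fin d → ℤ) → Circle)`, the h constant on each block (`mem_G0`, `G0_const_on_block`).
* §5 THE p. 306 SENTENCES, PROVED: 𝒢₀ *"affect[s] only bonds on the unit lattice which connect different blocks"*
  (`gaugeAct_eq_self_of_mem_G0`), *"preserve[s] the axial gauge"* (`IsAxial.gaugeAct_of_mem_G0`); AXIAL GAUGE FIXING ON
  EACH BLOCK TREE: existence — the gauge transformation `axialFix L u` (h(x) = u(Γ_{corner x, x})) puts every u in axial
  gauge (`isAxial_gaugeAct_axialFix`) — and uniqueness modulo 𝒢₀ — if u and u^h are both axial then h ∈ 𝒢₀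
  (`mem_G0_of_isAxial_gaugeAct`), two gauge transformations fixing the same u differ by an element of 𝒢₀
  (`div_mem_G0_of_isAxial`), packaged as `axialGauge_fixing` (∃ h, u^h axial ∧ ∀ h′, (u^{h′} axial ↔ h′/h ∈ 𝒢₀)); and
  the stabiliser of the axial gauge IS 𝒢₀ (`stabilizer_isAxial_eq_G0`).
NOT DONE HERE.  The functional integral (3.3) itself and the statement *"They generate the gauge group of the integral
𝒯(exp −S)"* beyond its typed content `stabilizer_isAxial_eq_G0`; maximality of T(y) as a graph-theoretic statement
(acyclicity) is not typed — what print uses of it, that T(y) reaches all of B(y) (`block_induction`) and that u_b = 1 on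
T(y) fixes the gauge exactly up to 𝒢₀ (§5), is proved; δ_{Ax} is typed by its support, not as a measure (the measure-level
tree gauge fixing with unit Jacobian is the cell's `T4AxialGaugeFixing`, general compact G, one box — pointer only).
-/

open Finset

namespace Literature.MathematicalPhysics.QuantumFieldTheory.BalabanImbrieJaffe1984to88.BIJ85AxialGauge34

open Literature.MathematicalPhysics.QuantumFieldTheory.Balaban1983to89
open B6Elimination B6BondElimination

noncomputable section

variable {d : ℕ} {L : ℕ}

/-! ## §1 The carrier dictionary and the gauge transformations (2.7) -/

/-- The compact abelian gauge field *"u : bonds → U(1)"* on the unit bonds ⟨z, z + e_μ⟩ of the unit lattice (ℤ^d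
dictionary, see the module docstring). [cite: BalabanImbrieJaffe1985, (1.1) p.300] -/
abbrev U1Cfg (d : ℕ) : Type := (Fin d → ℤ) × Fin d → Circle

/-- The gauge transformations *"h … a map from the unit lattice to U(1)"*. [cite: BalabanImbrieJaffe1985, (2.7) p.303] -/
abbrev GaugeFn (d : ℕ) : Type := (Fin d → ℤ) → Circle

/-- The complex scalar (Higgs) field on the unit lattice. [cite: BalabanImbrieJaffe1985, (1.1) p.300] -/
abbrev HiggsCfg (d : ℕ) : Type := (Fin d → ℤ) → ℂ

/-- The end-point b₊ = z + e_μ of the unit bond b = ⟨z, z + e_μ⟩. [cite: BalabanImbrieJaffe1985, (1.1) p.300] -/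
def tip (b : (Fin d → ℤ) × Fin d) : Fin d → ℤ := b.1 + unitVec b.2

/-- **(2.7)** *"u_b → h(b₋)h(b₊)^{−1}u_b = u^h_b"*. [cite: BalabanImbrieJaffe1985, (2.7) p.303] -/
def gaugeAct (h : GaugeFn d) (u : U1Cfg d) : U1Cfg d := fun b => h b.1 * (h (tip b))⁻¹ * u b

/-- **(2.7)** *"φ_y → h(y)φ_y ≡ φ^h_y"*. [cite: BalabanImbrieJaffe1985, (2.7) p.303] -/
def gaugeHiggs (h : GaugeFn d) (φ : HiggsCfg d) : HiggsCfg d := fun x => (h x : ℂ) * φ x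

/-- kernel: the value of u^h on one bond. [cite: BalabanImbrieJaffe1985, (2.7) p.303] -/
theorem gaugeAct_apply (h : GaugeFn d) (u : U1Cfg d) (b : (Fin d → ℤ) × Fin d) :
    gaugeAct h u b = h b.1 * (h (tip b))⁻¹ * u b := rfl

/-- The trivial gauge transformation acts trivially. [cite: BalabanImbrieJaffe1985, (2.7) p.303] -/
theorem gaugeAct_one (u : U1Cfg d) : gaugeAct 1 u = u := by
  funext b
  simp [gaugeAct]

/-- (2.7) is an action of the gauge group: u^{hh′} = (u^{h′})^h. [cite: BalabanImbrieJaffe1985, (2.7) p.303] -/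
theorem gaugeAct_mul (h h' : GaugeFn d) (u : U1Cfg d) : gaugeAct (h * h') u = gaugeAct h (gaugeAct h' u) := by
  funext b
  simp only [gaugeAct, Pi.mul_apply, mul_inv_rev]
  apply Circle.ext
  push_cast
  ring

/-- Changing the gauge-fixing transformation: u^{h₂} = (u^{h₁})^{h₂/h₁}. [cite: BalabanImbrieJaffe1985, (2.7) p.303] -/
theorem gaugeAct_div_gaugeAct (h₁ h₂ : GaugeFn d) (u : U1Cfg d) :
    gaugeAct (h₂ / h₁) (gaugeAct h₁ u) = gaugeAct h₂ u := by
  rw [← gaugeAct_mul, div_mul_cancel]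

/-! ## §2 Parallel transport along the contours Γ_{yx} (2.5) and induction along the block trees -/

/-- **(2.5)** *"u(Γ) = Π_{b∈Γ} u_b"* for the contour Γ = Γ_{yx} from the corner y of B(y) to x ∈ B(y): the product of the
bond variables over the unit bonds of Γ_{yx} (`B6BondElimination.contour`; U(1) is abelian, the order of the factors is
immaterial). [cite: BalabanImbrieJaffe1985, (2.5) p.302] -/
def hol (L : ℕ) (u : U1Cfg d) (y x : Fin d → ℤ) : Circle := ∏ b ∈ contour L y x, u b

/-- u(Γ_{yy}) = 1 (the empty contour). [cite: BalabanImbrieJaffe1985, (2.5) p.302] -/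
theorem hol_self (u : U1Cfg d) (y : Fin d → ℤ) : hol L u y y = 1 := by
  simp [hol, contour_self]

/-- Composition (2.5) along the tree: for a tree bond ⟨z, z + e_μ⟩ of B(y) (z_i = y_i for i < μ),
Γ_{y,z+e_μ} = Γ_{yz} ∘ ⟨z, z + e_μ⟩, so u(Γ_{y,z+e_μ}) = u_{⟨z,z+e_μ⟩} u(Γ_{yz}). [cite: BalabanImbrieJaffe1985, (2.5) p.302] -/
theorem hol_tip (u : U1Cfg d) {y z : Fin d → ℤ} {μ : Fin d} (hz : z ∈ block L y) (h1 : ∀ i, i < μ → z i = y i) :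
    hol L u y (z + unitVec μ) = u (z, μ) * hol L u y z := by
  unfold hol
  rw [contour_add_unitVec hz h1, Finset.prod_insert (not_mem_contour y z μ)]

/-- INDUCTION ALONG THE BLOCK TREE (the combinatorial content of *"T(y) is maximal"*: T(y) reaches every site of B(y)):
a property holding at the corner y and propagating along every tree bond ⟨z, z + e_μ⟩ ∈ T(y) holds on all of B(y).
Proof: peel the unit bond entering x along Γ_{yx} (the least coordinate in which x differs from y).
[cite: BalabanImbrieJaffe1985, (3.4) p.306] -/
theorem block_induction {P : (Fin d → ℤ) → Prop} (y : Fin d → ℤ) (h0 : P y)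
    (hstep : ∀ (z : Fin d → ℤ) (μ : Fin d), (z, μ) ∈ treeBonds L y → P z → P (z + unitVec μ)) :
    ∀ x ∈ block L y, P x := by
  suffices H : ∀ (n : ℕ) (x : Fin d → ℤ), x ∈ block L y → ∑ i, (x i - y i).toNat = n → P x from
    fun x hx => H _ x hx rfl
  intro n
  induction n using Nat.strong_induction_on with
  | _ n ih =>
    intro x hx hn
    by_cases hxy : x = y
    · rw [hxy]; exact h0
    -- the least coordinate in which x differs from y
    have hS : (Finset.univ.filter fun i : Fin d => x i ≠ y i).Nonempty := by
      by_contra hc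
      apply hxy
      funext i
      by_contra hne
      exact hc ⟨i, Finset.mem_filter.2 ⟨Finset.mem_univ i, hne⟩⟩
    set μ := (Finset.univ.filter fun i : Fin d => x i ≠ y i).min' hS with hμdef
    have hμ : x μ ≠ y μ := (Finset.mem_filter.1 (Finset.min'_mem _ hS)).2
    have hmin : ∀ i, i < μ → x i = y i := by
      intro i hi
      by_contra hne
      have : μ ≤ i := Finset.min'_le _ i (Finset.mem_filter.2 ⟨Finset.mem_univ i, hne⟩)
      exact absurd hi (not_lt.2 this)
    have hxb := mem_block.1 hx
    set z : Fin d → ℤ := x - unitVec μ with hzdef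
    have hz_apply : ∀ i, z i = x i - if i = μ then 1 else 0 := fun i => by
      rw [hzdef, Pi.sub_apply, unitVec_apply]
    have hzx : z + unitVec μ = x := by rw [hzdef, sub_add_cancel]
    have hxμ : y μ < x μ := lt_of_le_of_ne (hxb μ).1 (Ne.symm hμ)
    have htree : (z, μ) ∈ treeBonds L y := by
      rw [mem_treeBonds]
      refine ⟨mem_block.2 fun i => ?_, fun i hi => ?_, ?_⟩
      · show y i ≤ z i ∧ z i < y i + (L : ℤ)
        rw [hz_apply]
        obtain ⟨h1, h2⟩ := hxb i
        by_cases hi : i = μ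
        · subst hi; rw [if_pos rfl]; omega
        · rw [if_neg hi]; omega
      · show z i = y i
        rw [hz_apply, if_neg (ne_of_lt hi), sub_zero]
        exact hmin i hi
      · show z μ + 1 < y μ + L
        rw [hz_apply, if_pos rfl]
        have := (hxb μ).2
        omega
    have hzblk : z ∈ block L y := (mem_treeBonds.1 htree).1
    have hlt : ∑ i, (z i - y i).toNat < n := by
      have hle : ∀ i ∈ (Finset.univ : Finset (Fin d)), (z i - y i).toNat ≤ (x i - y i).toNat := fun i _ => by
        apply Int.toNat_le_toNat
        rw [hz_apply]
        split_ifs <;> omega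
      have hstrict : (z μ - y μ).toNat < (x μ - y μ).toNat := by
        rw [Int.toNat_lt_toNat (by omega), hz_apply, if_pos rfl]
        omega
      rw [← hn]
      exact Finset.sum_lt_sum hle ⟨μ, Finset.mem_univ _, hstrict⟩
    rw [← hzx]
    exact hstep z μ htree (ih _ hlt z hzblk rfl)

/-- The telescoping behind **(2.8)** on this carrier: u^h(Γ_{yx}) = h(y)u(Γ_{yx})h(x)^{−1} for x ∈ B(y). PROVED by
induction along the tree. [cite: BalabanImbrieJaffe1985, (2.8) p.303] -/
theorem hol_gaugeAct (h : GaugeFn d) (u : U1Cfg d) (y : Fin d → ℤ) :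
    ∀ x ∈ block L y, hol L (gaugeAct h u) y x = h y * hol L u y x * (h x)⁻¹ := by
  refine block_induction y ?_ ?_
  · rw [hol_self, hol_self, mul_one, mul_inv_cancel]
  · intro z μ hb ih
    obtain ⟨hz, h1, -⟩ := mem_treeBonds.1 hb
    rw [hol_tip _ hz h1, hol_tip _ hz h1, ih, gaugeAct_apply]
    simp only [tip]
    apply Circle.ext
    push_cast
    field_simp

/-! ## §3 (3.4): the block trees T(y) and the axial gauge -/

/-- `b ∈ T(y)` for the block B(y) containing b₋: the bonds on which (3.4) *"sets u_b = 1"* — the unit bonds of the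
contours Γ_{yx}, x ∈ B(y) (`B6BondElimination.treeBonds`: ⟨z, z + e_μ⟩ with z, z + e_μ ∈ B(y) and z_i = y_i for
i < μ). [cite: BalabanImbrieJaffe1985, (3.4) p.306] -/
def IsTreeBond (L : ℕ) (b : (Fin d → ℤ) × Fin d) : Prop := b ∈ treeBonds L (corner L b.1)

/-- **(3.4)** *"δ_{Ax}(u) = Π_{y∈T_L} Π_{b∈T(y)} δ(u_b)"*, typed by its support: u is in axial gauge iff u_b = 1 for every
bond b of every block tree T(y). [cite: BalabanImbrieJaffe1985, (3.4) p.306] -/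
def IsAxial (L : ℕ) (u : U1Cfg d) : Prop := ∀ b, IsTreeBond L b → u b = 1

/-- The corners y ∈ LZ^d: `corner L x` has coordinates divisible by L. [cite: BalabanImbrieJaffe1985, (2.4) p.302] -/
theorem dvd_corner (x : Fin d → ℤ) (i : Fin d) : (L : ℤ) ∣ corner L x i := by
  rw [corner_apply]
  exact dvd_mul_right _ _

/-- A tree bond of B(y), y ∈ LZ^d, starts in B(y): its block corner is y. [cite: BalabanImbrieJaffe1985, (3.4) p.306] -/
theorem corner_eq_of_mem_treeBonds (hL : 0 < L) {y : Fin d → ℤ} (hy : ∀ i, (L : ℤ) ∣ y i)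
    {b : (Fin d → ℤ) × Fin d} (hb : b ∈ treeBonds L y) : corner L b.1 = y := by
  have hz := (mem_treeBonds.1 hb).1
  rw [← corner_eq_self_of_dvd y hy] at hz
  rw [corner_eq_of_mem_block hL hz, corner_eq_self_of_dvd y hy]

/-- The tree bonds, block by block: `IsTreeBond L b` iff b ∈ T(y) for some corner y ∈ LZ^d.
[cite: BalabanImbrieJaffe1985, (3.4) p.306] -/
theorem isTreeBond_iff (hL : 0 < L) (b : (Fin d → ℤ) × Fin d) :
    IsTreeBond L b ↔ ∃ y : Fin d → ℤ, (∀ i, (L : ℤ) ∣ y i) ∧ b ∈ treeBonds L y := by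
  constructor
  · intro h
    exact ⟨corner L b.1, dvd_corner b.1, h⟩
  · rintro ⟨y, hy, hb⟩
    unfold IsTreeBond
    rwa [corner_eq_of_mem_treeBonds hL hy hb]

/-- (3.4) READ AS PRINTED (the double product): u is axial iff for every corner y ∈ T_L = LZ^d and every b ∈ T(y),
u_b = 1. [cite: BalabanImbrieJaffe1985, (3.4) p.306] -/
theorem isAxial_iff_blocks (hL : 0 < L) (u : U1Cfg d) :
    IsAxial L u ↔ ∀ y : Fin d → ℤ, (∀ i, (L : ℤ) ∣ y i) → ∀ b ∈ treeBonds L y, u b = 1 := by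
  constructor
  · intro h y hy b hb
    exact h b ((isTreeBond_iff hL b).2 ⟨y, hy, hb⟩)
  · intro h b hb
    obtain ⟨y, hy, hb'⟩ := (isTreeBond_iff hL b).1 hb
    exact h y hy b hb'

/-- A tree bond joins two sites OF THE SAME BLOCK: corner(b₊) = corner(b₋). [cite: BalabanImbrieJaffe1985, (3.4) p.306] -/
theorem corner_tip_eq (hL : 0 < L) {b : (Fin d → ℤ) × Fin d} (hb : IsTreeBond L b) :
    corner L (tip b) = corner L b.1 := by
  obtain ⟨hz, -, h2⟩ := mem_treeBonds.1 hb
  exact corner_eq_of_mem_block hL (add_unitVec_mem_block hz h2)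

/-- (3.4) READ AS ON p. 303 (*"set u_b = 1 for every b which occurs in some Γ_{yx}"* ⇔ u(Γ_{yx}) = 1 for all x ∈ B(y)):
u is axial iff every contour transport inside every block is trivial.  (⇐ is the telescoping
u_{⟨z,z+e_μ⟩} = u(Γ_{y,z+e_μ})u(Γ_{yz})^{−1} along the tree.) [cite: BalabanImbrieJaffe1985, (3.4) p.306] -/
theorem isAxial_iff_hol (hL : 0 < L) (u : U1Cfg d) :
    IsAxial L u ↔ ∀ y : Fin d → ℤ, (∀ i, (L : ℤ) ∣ y i) → ∀ x ∈ block L y, hol L u y x = 1 := by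
  rw [isAxial_iff_blocks hL]
  constructor
  · intro h y hy x hx
    exact Finset.prod_eq_one fun b hb => h y hy b (contour_subset_treeBonds hx hb)
  · intro h y hy b hb
    obtain ⟨hz, h1, h2⟩ := mem_treeBonds.1 hb
    have e1 := h y hy _ (add_unitVec_mem_block hz h2)
    rw [hol_tip u hz h1, h y hy _ hz, mul_one] at e1
    exact e1

/-- The trivial configuration is axial. [cite: BalabanImbrieJaffe1985, (3.4) p.306] -/
theorem isAxial_one : IsAxial L (1 : U1Cfg d) := fun _ _ => rfl

/-! ## §4 The residual gauge group 𝒢₀ -/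

/-- **𝒢₀** *"the subgroup of gauge transformations which are specified by h's in (2.7) which are constant on each
L-block B(y)"* — as a subgroup of the gauge group (h(x) = h(corner of the block of x)). [cite: BalabanImbrieJaffe1985, (3.4) p.306] -/
def G0 (L d : ℕ) : Subgroup (GaugeFn d) where
  carrier := {h | ∀ x, h x = h (corner L x)}
  mul_mem' := fun {a b} ha hb x => by simp only [Pi.mul_apply]; rw [ha x, hb x]
  one_mem' := fun _ => rfl
  inv_mem' := fun {a} ha x => by simp only [Pi.inv_apply]; rw [ha x]

/-- kernel: membership in 𝒢₀. [cite: BalabanImbrieJaffe1985, (3.4) p.306] -/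
theorem mem_G0 {h : GaugeFn d} : h ∈ G0 L d ↔ ∀ x, h x = h (corner L x) := Iff.rfl

/-- 𝒢₀ = the h *"constant on each L-block B(y)"*: h(x) = h(x′) whenever x, x′ lie in the same block.
[cite: BalabanImbrieJaffe1985, (3.4) p.306] -/
theorem mem_G0_iff_const (hL : 0 < L) {h : GaugeFn d} :
    h ∈ G0 L d ↔ ∀ x x' : Fin d → ℤ, corner L x = corner L x' → h x = h x' := by
  rw [mem_G0]
  constructor
  · intro hh x x' e
    rw [hh x, hh x', e]
  · intro hh x
    exact hh x _ (corner_corner hL x).symm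

/-- For h ∈ 𝒢₀ and y ∈ LZ^d: h = h(y) on B(y). [cite: BalabanImbrieJaffe1985, (3.4) p.306] -/
theorem G0_const_on_block (hL : 0 < L) {h : GaugeFn d} (hh : h ∈ G0 L d) {y x : Fin d → ℤ}
    (hy : ∀ i, (L : ℤ) ∣ y i) (hx : x ∈ block L y) : h x = h y := by
  rw [← corner_eq_self_of_dvd y hy] at hx
  rw [mem_G0.1 hh x, corner_eq_of_mem_block hL hx, corner_eq_self_of_dvd y hy]

/-! ## §5 The p. 306 sentences: 𝒢₀ and the axial gauge; gauge fixing on each block tree -/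

/-- *"[The transformations of 𝒢₀] affect only bonds on the unit lattice which connect different blocks"*: for h ∈ 𝒢₀,
u^h_b = u_b on every bond whose end-points lie in the same block. [cite: BalabanImbrieJaffe1985, (3.4) p.306] -/
theorem gaugeAct_eq_self_of_mem_G0 {h : GaugeFn d} (hh : h ∈ G0 L d) (u : U1Cfg d) {b : (Fin d → ℤ) × Fin d}
    (hb : corner L (tip b) = corner L b.1) : gaugeAct h u b = u b := by
  rw [gaugeAct_apply, mem_G0.1 hh b.1, mem_G0.1 hh (tip b), hb, mul_inv_cancel, one_mul]

/-- *"These gauge transformations preserve the axial gauge"*: h ∈ 𝒢₀ and u axial ⇒ u^h axial (tree bonds are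
intra-block). [cite: BalabanImbrieJaffe1985, (3.4) p.306] -/
theorem IsAxial.gaugeAct_of_mem_G0 (hL : 0 < L) {u : U1Cfg d} (hu : IsAxial L u) {h : GaugeFn d} (hh : h ∈ G0 L d) :
    IsAxial L (gaugeAct h u) := fun b hb => by
  rw [gaugeAct_eq_self_of_mem_G0 hh u (corner_tip_eq hL hb)]
  exact hu b hb

/-- THE AXIAL GAUGE-FIXING TRANSFORMATION of a configuration u: h_u(x) = u(Γ_{yx}), y the corner of the block of x
(p. 303 *"we choose h in order to set u_b = 1 for every b which occurs in some Γ_{yx}"*). [cite: BalabanImbrieJaffe1985, (3.4) p.306] -/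
def axialFix (L : ℕ) (u : U1Cfg d) : GaugeFn d := fun x => hol L u (corner L x) x

/-- EXISTENCE of the axial gauge on every block tree: u^{h_u} is axial, for every u.  (Along a tree bond ⟨z, z + e_μ⟩ of
B(y): h_u(z)h_u(z + e_μ)^{−1}u_b = u(Γ_{yz})(u_b u(Γ_{yz}))^{−1}u_b = 1.) [cite: BalabanImbrieJaffe1985, (3.4) p.306] -/
theorem isAxial_gaugeAct_axialFix (hL : 0 < L) (u : U1Cfg d) : IsAxial L (gaugeAct (axialFix L u) u) := by
  intro b hb
  obtain ⟨hz, h1, -⟩ := mem_treeBonds.1 hb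
  rw [gaugeAct_apply, axialFix, axialFix, corner_tip_eq hL hb, tip, hol_tip u hz h1, mul_inv_rev, ← mul_assoc,
    mul_inv_cancel, one_mul, inv_mul_cancel]

/-- UNIQUENESS MODULO 𝒢₀: if u and u^h are both in axial gauge then h ∈ 𝒢₀ (h(z + e_μ) = h(z) along every tree bond,
and T(y) reaches all of B(y)). [cite: BalabanImbrieJaffe1985, (3.4) p.306] -/
theorem mem_G0_of_isAxial_gaugeAct (hL : 0 < L) {u : U1Cfg d} (hu : IsAxial L u) {h : GaugeFn d}
    (hh : IsAxial L (gaugeAct h u)) : h ∈ G0 L d := by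
  rw [mem_G0]
  intro x
  have key : ∀ x' ∈ block L (corner L x), h x' = h (corner L x) := by
    refine block_induction (corner L x) rfl ?_
    intro z μ hb ih
    have htb : IsTreeBond L (z, μ) := (isTreeBond_iff hL _).2 ⟨corner L x, dvd_corner x, hb⟩
    have e1 := hh (z, μ) htb
    rw [gaugeAct_apply, hu (z, μ) htb, mul_one, mul_inv_eq_one] at e1
    rw [← ih]
    exact e1.symm
  exact key x (mem_block_corner hL x)

/-- Two gauge transformations that both put u in axial gauge differ by an element of 𝒢₀.
[cite: BalabanImbrieJaffe1985, (3.4) p.306] -/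
theorem div_mem_G0_of_isAxial (hL : 0 < L) (u : U1Cfg d) {h₁ h₂ : GaugeFn d} (h1 : IsAxial L (gaugeAct h₁ u))
    (h2 : IsAxial L (gaugeAct h₂ u)) : h₂ / h₁ ∈ G0 L d :=
  mem_G0_of_isAxial_gaugeAct hL h1 (by rwa [gaugeAct_div_gaugeAct])

/-- AXIAL GAUGE FIXING ON THE BLOCK TREES — existence and uniqueness modulo 𝒢₀ in one statement: every u has a gauge
transform in axial gauge, and the gauge transformations achieving this form one 𝒢₀-coset. [cite: BalabanImbrieJaffe1985, (3.4) p.306] -/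
theorem axialGauge_fixing (hL : 0 < L) (u : U1Cfg d) :
    ∃ h : GaugeFn d, IsAxial L (gaugeAct h u) ∧ ∀ h' : GaugeFn d, IsAxial L (gaugeAct h' u) ↔ h' / h ∈ G0 L d := by
  refine ⟨axialFix L u, isAxial_gaugeAct_axialFix hL u, fun h' => ⟨fun h1 => ?_, fun hm => ?_⟩⟩
  · exact div_mem_G0_of_isAxial hL u (isAxial_gaugeAct_axialFix hL u) h1
  · rw [← gaugeAct_div_gaugeAct (axialFix L u) h' u]
    exact (isAxial_gaugeAct_axialFix hL u).gaugeAct_of_mem_G0 hL hm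

/-- The stabiliser of the axial gauge IS 𝒢₀ (the typed content of *"preserve the axial gauge … They generate the gauge
group of the integral 𝒯(exp −S)"*): a gauge transformation maps axial configurations to axial configurations iff it is
constant on blocks. [cite: BalabanImbrieJaffe1985, (3.4) p.306] -/
theorem stabilizer_isAxial_eq_G0 (hL : 0 < L) :
    {h : GaugeFn d | ∀ u : U1Cfg d, IsAxial L u → IsAxial L (gaugeAct h u)} = G0 L d := by
  ext h
  constructor
  · intro hh
    exact mem_G0_of_isAxial_gaugeAct hL isAxial_one (hh 1 isAxial_one)
  · intro hh u hu
    exact hu.gaugeAct_of_mem_G0 hL hh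

end

end Literature.MathematicalPhysics.QuantumFieldTheory.BalabanImbrieJaffe1984to88.BIJ85AxialGauge34
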